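import Summits.SmoothPoincare4.SmoothPoincare4.Theses.SteinHost
import Literature.Topology.FourManifolds.CerfGammaFour
import Literature.Topology.FourManifolds.TwistedSpheres
import Literature.Topology.FourManifolds.ClosedBall
import Literature.Topology.FourManifolds.CorkDecomposition
import Literature.Topology.FourManifolds.HomotopyS4CompactProofs
import Literature.Geometry.Symplectic.SteinDomain
import Literature.Topology.FourManifolds.SphereSimplyConnected
import Mathlib.Topology.Homotopy.Contractible

/-!
# Birth skeleton — crux `SteinSchoenflies` (item `stmt-SmoothPoincare4-18228`), line `birth`

Route `route-SmoothPoincare4-SteinHost` ("fake balls in a Stein host"), rank-2 crux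
`Summit.SmoothPoincare4.SmoothPoincare4.Theses.SteinHost.SteinSchoenflies`:

> for every Hausdorff second-countable `C^∞` 4-manifold `M ≃ₕ S⁴`, every `p ∈ M`, every compact Hausdorff
> second-countable `C^∞` 4-manifold with boundary `X` admitting a Stein structure, and every smooth embedding
> `f : M ∖ {p} ↪ X`, the manifold `M` is diffeomorphic to `S⁴`.

THE LINE is the route header's two-layer plan, `SteinSchoenflies ⇐ BallInHost → LambertCole110 → Cerf`, with the
homotopy-theoretic input ("the compact piece is a homotopy ball") split off as its own stub so that every stub is
ONE kind of mathematics: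

* `stub_ballInHost` (differential topology, Palais' disc / chart-ball excision; a THEOREM, size L): for ANY compact
  boundaryless smooth 4-manifold `M`, any `p ∈ M` and any smooth embedding `f` of the punctured manifold `M ∖ {p}`
  into a smooth 4-manifold with boundary `X`, there is a compact smooth 4-manifold with boundary `B` (intended:
  `M` minus a small open chart ball round `p`), a boundary datum `b` of `B` with `∂B ≅ S³` (`φ`), a smooth embedding
  `e : B ↪ X` into the INTERIOR of `X` (intended: `f` restricted), and a presentation of `M` as the boundary gluing
  `M = B ∪_φ 𝔻⁴` (`IsBoundaryGluing b (closedBallBoundaryData 3) φ (𝓡 4) M`). No homotopy hypothesis.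
* `stub_complementContractible` (algebraic topology; a THEOREM, size M): if `M ≃ₕ S⁴` and `M = B ∪_φ 𝔻⁴` for a
  compact `B` with `∂B ≅ S³`, then `B` is contractible — `B ≅ M ∖ (open ball)` is a deformation retract of
  `M ∖ {pt}`, which is contractible for a homotopy 4-sphere (tree, PROVED:
  `Literature.Topology.FourManifolds.contractibleSpace_compl_singleton_of_homotopyEquiv_sphere_four`).
* `stub_lambertCole110` (THE HEART — Lambert-Cole's Stein–Schoenflies conjecture, arXiv:2104.02003 Conj. 1.10
  p. 4, verbatim in the tree's vocabulary; open problem): in a compact Stein domain `X`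
  (`Literature.Geometry.Symplectic.IsSteinDomain X`) every smoothly embedded (into `Int X`) compact CONTRACTIBLE
  4-manifold `B` with boundary diffeomorphic to `S³` — an embedded homotopy 4-ball bounded by a smoothly embedded
  `S³` — is diffeomorphic to the standard ball `𝔻⁴`. Contains the smooth 4-dimensional Schoenflies conjecture
  (`X = 𝔻⁴ ⊂ ℂ²`, tree `Literature.Geometry.Symplectic.isSteinDomain_closedBall`); SPC4-shielded (a counterexample
  is an exotic `S⁴`).
* `stub_cerfGammaFour` (a THEOREM, formal debt XL): Cerf's `Γ₄ = 0` in twisted-sphere form — BY NAME the tree's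
  named fact `Literature.Topology.FourManifolds.cerf_twistedSphere_four` (same stub as in the registered skeletons
  of `RungFour` and `GreatFibrationBaseStandard`; closes the day the fact or item `SchsplitCerf` lands).

`SteinSchoenflies_of : stub₁-sig → stub₂-sig → stub₃-sig → stub₄-sig → SteinSchoenflies` is the REAL composition
(sorry-free): `M` is compact (tree, PROVED: `compactSpace_of_homotopyEquiv_sphere_four_holds`); stub 1 splits
`M = B ∪_φ 𝔻⁴` and embeds `B` in `Int X`; stub 2 makes `B` contractible; the heart gives `Φ : B ≅ 𝔻⁴`; transporting
the gluing along `Φ⁻¹` (tree, PROVED: `IsBoundaryGluing.transfer`, `BoundaryData.restrictDiffeomorph`) presents `M`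
as a twisted sphere `𝔻⁴ ∪_χ 𝔻⁴`, `χ = ∂Φ⁻¹ ≫ φ ∈ Diff(S³)`, bundled as a `TwistedSphere 3 χ`; Cerf concludes. Its
hypotheses are the stub statements under the name-keyed aliases `Registered.stub_*`; the closing
`example : SteinSchoenflies` wires the four sorried stubs into it. `sorry` occurs ONLY in the four `stub_*` theorems.

Disproof used: none — `ledger crux ls stmt-SmoothPoincare4-18228` showed no workfiles (no `Disproof.lean`, no
`_false_without_` theorem, no `Theorems/SteinSchoenflies/Negative/*`) at registration (2026-08-17); negatives index
(`ledger negatives --problem SmoothPoincare4`): 0 refuted statements. Load-bearing hypotheses honoured: the Stein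
structure of the host enters ONLY the heart (`stub_lambertCole110`; without it the statement is the smooth Schoenflies
problem in an arbitrary compact 4-manifold, false as typed: `B` = a fake ball, `X` = its double); the homotopy
equivalence `M ≃ₕ S⁴` enters ONLY `stub_complementContractible` (round `ℝℙ⁴ ∖ pt ↪` a Stein tube would otherwise
be in scope). Barriers: OpenAnalogueBarrierFour respected (the object recognised is the COMPACT piece `B` with `S³`
boundary inside `Int X`, never `M ∖ {p}` or `Int B`); RelativeContractibleBarrierFour not engaged (`∂B = S³`, no
extension-over-a-cork claim); TwistedSphereBarrierFour used positively only (Cerf as stub 4); StableBarrierFour /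
HCobordismBarrierFour not invoked.
-/

set_option linter.dupNamespace false

noncomputable section

open scoped Manifold ContDiff Topology
open Set Function

namespace Summit.SmoothPoincare4.SmoothPoincare4.Cruxes.SteinSchoenflies.Birth

open Summit.SmoothPoincare4.SmoothPoincare4.Theses.SteinHost (SteinSchoenflies)
open Literature.Topology.FourManifolds Literature.Geometry.Symplectic

/-! ## The four registered stubs

Lead reshape (prover-line-stmt-SmoothPoincare4-18228-0, cycle 1): `stub_ballInHost` carries the extra binder
`[ConnectedSpace M]` (supplied in `SteinSchoenflies_of` from `M ≃ₕ S⁴`), so that the excised chart ball can be moved to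
the prescribed point `p` by homogeneity of connected manifolds. -/

/-- **Stub 1 — the compact fake ball sits in the host (chart-ball excision; Palais).**
For every compact Hausdorff second-countable smooth 4-manifold `M` (no boundary), every `p ∈ M`, every Hausdorff
second-countable smooth 4-manifold with boundary `X` and every smooth embedding `f : M ∖ {p} ↪ X` there are: a
compact Hausdorff second-countable smooth 4-manifold with boundary `B`, a boundary datum `b` of `B` with a
diffeomorphism `φ : ∂B ≅ S³`, a smooth embedding `e : B ↪ X` with image in the interior of `X`, and a presentation
of `M` as the boundary gluing `B ∪_φ 𝔻⁴`. Intended witness: `B = M ∖ i(open unit ball)` for a chart disc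
`i : ℝ⁴ ↪ M` centred at `p` (a compact codimension-0 submanifold with boundary `i(S³)`; cf. the tree's
`BallRemovalData`, `GluingConstructionBoundary.lean`), `e = f|_B` (an immersion of a boundaryless 4-manifold into
`X` misses `∂X`), the gluing pieces `B ↪ M` and `i|_{𝔻⁴}`.
Why plausibly true: it is a theorem of differential topology (Palais 1960 / Cerf: discs round a point; Hirsch 1976
§8.2). Size: L (formal: the `𝓡∂ 4` atlas on the ball complement and the seam bookkeeping).
[cite: HirschDT1976, §8.2] [cite: KervaireMilnorAnnals1963, proof of Lemma 2.3] -/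
theorem stub_ballInHost :
    ∀ (M : Type) [TopologicalSpace M] [T2Space M] [SecondCountableTopology M]
      [ChartedSpace (EuclideanSpace ℝ (Fin 4)) M] [IsManifold (𝓡 4) ∞ M] [CompactSpace M]
      [ConnectedSpace M] (p : M)
      (X : Type) [TopologicalSpace X] [T2Space X] [SecondCountableTopology X]
      [ChartedSpace (EuclideanHalfSpace 4) X] [IsManifold (𝓡∂ 4) ∞ X]
      (f : (⟨{p}ᶜ, isOpen_compl_singleton⟩ : TopologicalSpace.Opens M) → X),
      Manifold.IsSmoothEmbedding (𝓡 4) (𝓡∂ 4) ∞ f →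
      ∃ (B : Type) (_ : TopologicalSpace B) (_ : T2Space B) (_ : SecondCountableTopology B)
        (_ : ChartedSpace (EuclideanHalfSpace 4) B) (_ : IsManifold (𝓡∂ 4) ∞ B) (_ : CompactSpace B)
        (b : Literature.Topology.FourManifolds.BoundaryData (𝓡∂ 4) B (𝓡 3))
        (φ : b.carrier ≃ₘ⟮𝓡 3, 𝓡 3⟯ (Metric.sphere (0 : EuclideanSpace ℝ (Fin 4)) 1))
        (e : B → X),
        Manifold.IsSmoothEmbedding (𝓡∂ 4) (𝓡∂ 4) ∞ e ∧
          Set.range e ⊆ (𝓡∂ 4).interior X ∧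
          Literature.Topology.FourManifolds.IsBoundaryGluing b
            (Literature.Topology.FourManifolds.closedBallBoundaryData 3) φ (𝓡 4) M := by
  sorry

/-- **Stub 2 — the ball complement of a homotopy 4-sphere is contractible.**
If `M ≃ₕ S⁴` (Hausdorff, second countable, smooth) is a boundary gluing `B ∪_φ 𝔻⁴` of a compact 4-manifold with
boundary `B`, `∂B ≅ S³`, and the closed 4-disc, then `B` is contractible: the piece embedding identifies `B` with
`M ∖ j(open ball)`, a deformation retract (radially inside the disc `j(𝔻⁴)`) of `M ∖ {j 0}`, and a punctured
homotopy 4-sphere is contractible (tree, PROVED: `contractibleSpace_compl_singleton_of_homotopyEquiv_sphere_four`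
— acyclic by Mayer–Vietoris, simply connected by general position, Whitehead–Hurewicz).
Why plausibly true: it is a theorem. Size: M (formal: the radial deformation retraction glued by the pasting lemma).
[cite: FreedmanJDG1982, proof of Thm. 1.6 p. 371] [cite: HatcherAT2002, Prop. 3.29] -/
theorem stub_complementContractible :
    ∀ (M : Type) [TopologicalSpace M] [T2Space M] [SecondCountableTopology M]
      [ChartedSpace (EuclideanSpace ℝ (Fin 4)) M] [IsManifold (𝓡 4) ∞ M],
      ContinuousMap.HomotopyEquiv M (Metric.sphere (0 : EuclideanSpace ℝ (Fin 5)) 1) →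
      ∀ (B : Type) [TopologicalSpace B] [T2Space B] [SecondCountableTopology B]
        [ChartedSpace (EuclideanHalfSpace 4) B] [IsManifold (𝓡∂ 4) ∞ B] [CompactSpace B]
        (b : Literature.Topology.FourManifolds.BoundaryData (𝓡∂ 4) B (𝓡 3))
        (φ : b.carrier ≃ₘ⟮𝓡 3, 𝓡 3⟯ (Metric.sphere (0 : EuclideanSpace ℝ (Fin 4)) 1)),
        Literature.Topology.FourManifolds.IsBoundaryGluing b
            (Literature.Topology.FourManifolds.closedBallBoundaryData 3) φ (𝓡 4) M →
        ContractibleSpace B := by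
  sorry

/-- **Stub 3 (THE HEART) — Lambert-Cole's Stein–Schoenflies conjecture (arXiv:2104.02003, Conj. 1.10, p. 4):**
"Let `X` be a compact Stein domain of complex dimension 2 and let `B ⊂ X` be an embedded homotopy 4-ball bounded by
a smoothly embedded `S³`. Then `B` is a standard 4-ball." In the tree's vocabulary: for every compact Hausdorff
second-countable smooth 4-manifold with boundary `X` admitting a Stein structure (`IsSteinDomain X`: integrable `J`
and a `J`-convex `φ` presenting `∂X` as its regular maximal level set), every compact CONTRACTIBLE Hausdorff
second-countable smooth 4-manifold with boundary `B` whose boundary (datum `b`) is diffeomorphic to `S³`, and every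
smooth embedding `e : B ↪ X` with image in the interior of `X`, the manifold `B` is diffeomorphic to `𝔻⁴`.
Why plausibly true: Lambert-Cole's programme — Thm. 1.2 (any homotopy ball in `ℂ²` re-embeds as a union
`Z = Z₁ ∪ Z₂ ∪ Z₃` of three pseudoconvex pieces, from a Stein trisection of `B⁴` reducible w.r.t. `∂B` plus the
Bedford–Klingenberg Levi-flat filling, "applies in all Stein surfaces"), Thm. 1.4 (spine = Shilov boundary ⇒ `Z`
pseudoconvex ⇒ `B ≅ B⁴` by Eliashberg's filling theorem, tree fact
`Literature.Geometry.Symplectic.Eliashberg1990_steinFilling_sphere_three`). Why it might fail: the hulls / envelope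
of holomorphy of `Z` are unknown and `∂B` is not Levi-convex (Q1.3 open even in `ℂ²`); it contains the smooth
Schoenflies conjecture (`X = 𝔻⁴`, `isSteinDomain_closedBall`). Size: open-problem (SPC4-shielded).
[cite: Lambertcole2021, Conj. 1.10 and Thms. 1.2, 1.4] [cite: Eliashberg1990, Thm. 5.1] -/
theorem stub_lambertCole110 :
    ∀ (X : Type) [TopologicalSpace X] [T2Space X] [SecondCountableTopology X]
      [ChartedSpace (EuclideanHalfSpace 4) X] [IsManifold (𝓡∂ 4) ∞ X] [CompactSpace X],
      Literature.Geometry.Symplectic.IsSteinDomain X →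
      ∀ (B : Type) [TopologicalSpace B] [T2Space B] [SecondCountableTopology B]
        [ChartedSpace (EuclideanHalfSpace 4) B] [IsManifold (𝓡∂ 4) ∞ B] [CompactSpace B]
        [ContractibleSpace B]
        (b : Literature.Topology.FourManifolds.BoundaryData (𝓡∂ 4) B (𝓡 3))
        (φ : b.carrier ≃ₘ⟮𝓡 3, 𝓡 3⟯ (Metric.sphere (0 : EuclideanSpace ℝ (Fin 4)) 1))
        (e : B → X), Manifold.IsSmoothEmbedding (𝓡∂ 4) (𝓡∂ 4) ∞ e →
        Set.range e ⊆ (𝓡∂ 4).interior X →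
        Nonempty (B ≃ₘ⟮𝓡∂ 4, 𝓡∂ 4⟯ (Metric.closedBall (0 : EuclideanSpace ℝ (Fin 4)) 1)) := by
  sorry

/-- **Stub 4 — Cerf's `Γ₄ = 0`, twisted-sphere form, BY NAME the tree's named fact**
`Literature.Topology.FourManifolds.cerf_twistedSphere_four`: every twisted 4-sphere `D⁴ ∪_φ D⁴` (any bundled
`TwistedSphere 3 φ`) is diffeomorphic to `S⁴` (Cerf 1968, main theorem; Kervaire–Milnor 1963 §1). Verbatim the
body of the SchoenfliesSplit item `SchsplitCerf` (stmt-SmoothPoincare4-8758) and of `stub_cerfGammaFour` of the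
registered skeletons of `RungFour` / `GreatFibrationBaseStandard`; the tree already reduces the fact to
`π₀ Diff(D³ rel ∂) = 0` (`cerf_twistedSphere_four_of_relBoundary`). Why plausibly true: it is a theorem.
Size: XL (formal debt, no research content). [cite: Cerf1968, main theorem (Γ₄ = 0)] [cite: KervaireMilnor1963, §1] -/
theorem stub_cerfGammaFour : Literature.Topology.FourManifolds.cerf_twistedSphere_four := by
  sorry

/-! ## Name-keyed aliases of the four stub statements (hypotheses of the composition) -/
namespace Registered

/-- Alias: the signature of `stub_ballInHost`. -/
abbrev stub_ballInHost : Prop :=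
    ∀ (M : Type) [TopologicalSpace M] [T2Space M] [SecondCountableTopology M]
      [ChartedSpace (EuclideanSpace ℝ (Fin 4)) M] [IsManifold (𝓡 4) ∞ M] [CompactSpace M]
      [ConnectedSpace M] (p : M)
      (X : Type) [TopologicalSpace X] [T2Space X] [SecondCountableTopology X]
      [ChartedSpace (EuclideanHalfSpace 4) X] [IsManifold (𝓡∂ 4) ∞ X]
      (f : (⟨{p}ᶜ, isOpen_compl_singleton⟩ : TopologicalSpace.Opens M) → X),
      Manifold.IsSmoothEmbedding (𝓡 4) (𝓡∂ 4) ∞ f →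
      ∃ (B : Type) (_ : TopologicalSpace B) (_ : T2Space B) (_ : SecondCountableTopology B)
        (_ : ChartedSpace (EuclideanHalfSpace 4) B) (_ : IsManifold (𝓡∂ 4) ∞ B) (_ : CompactSpace B)
        (b : Literature.Topology.FourManifolds.BoundaryData (𝓡∂ 4) B (𝓡 3))
        (φ : b.carrier ≃ₘ⟮𝓡 3, 𝓡 3⟯ (Metric.sphere (0 : EuclideanSpace ℝ (Fin 4)) 1))
        (e : B → X),
        Manifold.IsSmoothEmbedding (𝓡∂ 4) (𝓡∂ 4) ∞ e ∧
          Set.range e ⊆ (𝓡∂ 4).interior X ∧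
          Literature.Topology.FourManifolds.IsBoundaryGluing b
            (Literature.Topology.FourManifolds.closedBallBoundaryData 3) φ (𝓡 4) M

/-- Alias: the signature of `stub_complementContractible`. -/
abbrev stub_complementContractible : Prop :=
    ∀ (M : Type) [TopologicalSpace M] [T2Space M] [SecondCountableTopology M]
      [ChartedSpace (EuclideanSpace ℝ (Fin 4)) M] [IsManifold (𝓡 4) ∞ M],
      ContinuousMap.HomotopyEquiv M (Metric.sphere (0 : EuclideanSpace ℝ (Fin 5)) 1) →
      ∀ (B : Type) [TopologicalSpace B] [T2Space B] [SecondCountableTopology B]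
        [ChartedSpace (EuclideanHalfSpace 4) B] [IsManifold (𝓡∂ 4) ∞ B] [CompactSpace B]
        (b : Literature.Topology.FourManifolds.BoundaryData (𝓡∂ 4) B (𝓡 3))
        (φ : b.carrier ≃ₘ⟮𝓡 3, 𝓡 3⟯ (Metric.sphere (0 : EuclideanSpace ℝ (Fin 4)) 1)),
        Literature.Topology.FourManifolds.IsBoundaryGluing b
            (Literature.Topology.FourManifolds.closedBallBoundaryData 3) φ (𝓡 4) M →
        ContractibleSpace B

/-- Alias: the signature of `stub_lambertCole110`. -/
abbrev stub_lambertCole110 : Prop :=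
    ∀ (X : Type) [TopologicalSpace X] [T2Space X] [SecondCountableTopology X]
      [ChartedSpace (EuclideanHalfSpace 4) X] [IsManifold (𝓡∂ 4) ∞ X] [CompactSpace X],
      Literature.Geometry.Symplectic.IsSteinDomain X →
      ∀ (B : Type) [TopologicalSpace B] [T2Space B] [SecondCountableTopology B]
        [ChartedSpace (EuclideanHalfSpace 4) B] [IsManifold (𝓡∂ 4) ∞ B] [CompactSpace B]
        [ContractibleSpace B]
        (b : Literature.Topology.FourManifolds.BoundaryData (𝓡∂ 4) B (𝓡 3))
        (φ : b.carrier ≃ₘ⟮𝓡 3, 𝓡 3⟯ (Metric.sphere (0 : EuclideanSpace ℝ (Fin 4)) 1))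
        (e : B → X), Manifold.IsSmoothEmbedding (𝓡∂ 4) (𝓡∂ 4) ∞ e →
        Set.range e ⊆ (𝓡∂ 4).interior X →
        Nonempty (B ≃ₘ⟮𝓡∂ 4, 𝓡∂ 4⟯ (Metric.closedBall (0 : EuclideanSpace ℝ (Fin 4)) 1))

/-- Alias: the signature of `stub_cerfGammaFour`. -/
abbrev stub_cerfGammaFour : Prop :=
    Literature.Topology.FourManifolds.cerf_twistedSphere_four

end Registered

/-! ## The composition (kernel-checked, sorry-free) -/

/-- **Skeleton theorem — the crux BY NAME from the four stubs.** Given the binders of `SteinSchoenflies`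
(`M`, `he : M ≃ₕ S⁴`, `p`, a compact Stein domain `X`, a smooth embedding `f : M ∖ {p} ↪ X`): `M` is compact
(`compactSpace_of_homotopyEquiv_sphere_four_holds`); stub 1 presents `M = B ∪_φ 𝔻⁴` with `B ↪ Int X`; stub 2
makes `B` contractible; the heart gives `Φ : B ≅ 𝔻⁴`; `IsBoundaryGluing.transfer` along `Φ⁻¹` presents `M` as the
twisted sphere `𝔻⁴ ∪_χ 𝔻⁴`, `χ = ∂Φ⁻¹ ≫ φ`, and Cerf's `Γ₄ = 0` gives `M ≅ S⁴`.
[cite: KervaireMilnor1963, §1] [cite: Cerf1968, main theorem (Γ₄ = 0)] [cite: Lambertcole2021, Conj. 1.10] -/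
theorem SteinSchoenflies_of :
    Registered.stub_ballInHost → Registered.stub_complementContractible →
      Registered.stub_lambertCole110 → Registered.stub_cerfGammaFour → SteinSchoenflies := by
  intro hBall hContr hHeart hCerf M _ _ _ _ _ he p X _ _ _ _ _ _ hX f hf
  -- a homotopy 4-sphere is compact
  haveI : CompactSpace M := compactSpace_of_homotopyEquiv_sphere_four_holds M he
  -- a homotopy 4-sphere is connected (simply connected: `π₁(S⁴) = 1` transported along `he`)
  haveI : SimplyConnectedSpace M :=
    simplyConnectedSpace_of_homotopyEquiv_sphere_four simplyConnectedSpace_sphere_four_holds M he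
  haveI : ConnectedSpace M := inferInstance
  -- split off a chart ball round `p`: `M = B ∪_φ 𝔻⁴`, with the compact piece `B` embedded in `Int X`
  obtain ⟨B, _, _, _, _, _, _, b, φ, e, heemb, hint, hglue⟩ := hBall M p X f hf
  -- the compact piece is a homotopy ball
  haveI : ContractibleSpace B := hContr M he B b φ hglue
  -- Lambert-Cole's conjecture: the embedded homotopy ball is standard
  obtain ⟨Φ⟩ := hHeart X hX B b φ e heemb hint
  -- transport the gluing along `Φ⁻¹ : 𝔻⁴ ≅ B`: `M` is a twisted sphere `𝔻⁴ ∪_χ 𝔻⁴`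
  let D : BoundaryData (𝓡∂ 4) (Metric.closedBall (0 : EuclideanSpace ℝ (Fin 4)) 1) (𝓡 3) :=
    closedBallBoundaryData 3
  have hT : IsBoundaryGluing D (closedBallBoundaryData 3) (φ ∘ D.restrictDiffeomorph b Φ.symm) (𝓡 4) M :=
    IsBoundaryGluing.transfer (b₁ := D) Φ.symm hglue
  let χ : (Metric.sphere (0 : EuclideanSpace ℝ (Fin 4)) 1) ≃ₘ⟮𝓡 3, 𝓡 3⟯
      (Metric.sphere (0 : EuclideanSpace ℝ (Fin 4)) 1) :=
    (D.restrictDiffeomorph b Φ.symm).trans φ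
  have hχ : IsTwistedSphere 3 χ M := hT
  -- Cerf's `Γ₄ = 0`
  have hC : cerf_twistedSphere_four := hCerf
  exact hC χ { carrier := M, isTwistedSphere := hχ }

/-- Wiring check: the four registered stubs feed `SteinSchoenflies_of` exactly as stated (aliases = signatures), so
the skeleton is `SteinSchoenflies` closed modulo the stubs; sorries enter only through them. -/
example : SteinSchoenflies :=
  SteinSchoenflies_of stub_ballInHost stub_complementContractible stub_lambertCole110 stub_cerfGammaFour

end Summit.SmoothPoincare4.SmoothPoincare4.Cruxes.SteinSchoenflies.Birth

end
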